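import Summits.CriticalPhenomena.PercolationContinuityZ3.Theorems.PercNearOneGluingNoHeavyLowerTailSahiCombMixFourOfFive
import Summits.CriticalPhenomena.PercolationContinuityZ3.Theorems.PercNearOneGluingNoHeavyLowerTailSahiCombMixFiveSingleMain

/-!
# The comb hierarchy for Sahi's `E_k`, C: GROWING FIVE EVENTS by AND steps (any sub-collection) and OR steps into at most one OR at least four members

Support file of the one-cut programme (crux `NoHeavyLowerTail`, stmt-CriticalPhenomena-4575; cell `prim-masterthm`, seat P3, gen 12;
`run/shared/lean/prim/prim-masterthm/prim-masterthm-p3/HIERARCHY.md` §20).  The usable corollary of the `n = 5` OR ladder "comb H-MIX(5) holds iff `|G| ∉ {2,3}`":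
OR steps `sel i` (`combHereditary_orCoord_sel`, every `n`, gen 11), "all but `u`" (`combHereditary_orCoord_five_allBut'`, this gen) and "all five"
(`combHereditary_orCoord_five_all`, this gen), AND steps into any sub-collection (`combHereditary_andCoord`, gen 9).
* **`combHereditary_grow_five_notTwoThree`** — a `CombHereditary` quintuple of increasing events determined by `S`, grown by such steps on pairwise distinct fresh
  coordinates, stays `CombHereditary`; law shadow `sahiE_grow_five_notTwoThree_nonneg`;
* **`combHereditary_caterpillar_five_notTwoThree`** — from a constant start: every quintuple of common-order monotone read-once decision lists in which every coordinate is
  an ACCEPTING literal of at most one or at least four of the five lists (rejecting literals unrestricted) is hereditarily comb-positive; `E_5 ≥ 0` under every product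
  measure (`sahiE_five_caterpillar_notTwoThree_nonneg`).
HONEST FRAMING: closure properties of the hereditary comb class of five events; nothing here asserts (M⁺-k) or `C_k` for `k ≥ 3`. [this work]
-/

noncomputable section

open scoped Classical

namespace Summit.CriticalPhenomena.PercolationContinuityZ3.Theorems

open Finset Function
open Literature.Combinatorics.Sahi2008
open Literature.Probability.Percolation (DeterminedBy)
open Literature.Probability.Percolation.DecisionTree (ind)
open SahiComb
open SahiCombDisjunct (orCoord)
open SahiCombHereditary (CombHereditary MixStep mixStep grow caterpillar isUpperSet_grow secAt_grow_of_notMem caterpillar_eq_grow combHereditary_andCoord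
  combHereditary_constFamily)

variable {ι : Type} [Fintype ι]

namespace SahiCombMix

/-- The admissible OR selectors at `n = 5`: one member, all but one member, or all members. [this work] -/
def OrSelOK (G : Fin 5 → Bool) : Prop :=
  (∃ i, G = sel i) ∨ (∃ u, G = fun j => decide (j ≠ u)) ∨ G = fun _ => true

/-- **GROWING FIVE HEREDITARILY COMB-POSITIVE EVENTS** by AND steps into any sub-collection and OR steps into `≤ 1` or `≥ 4` members. [this work] -/
theorem combHereditary_grow_five_notTwoThree {U : Fin 5 → Set (Set ι)} (hUup : ∀ j, IsUpperSet (U j)) {S : Set ι} (hUS : ∀ j, DeterminedBy (U j) S)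
    (hU : CombHereditary U) :
    ∀ (L : List (MixStep ι 5)), (L.map MixStep.coord).Nodup → (∀ s ∈ L, s.coord ∉ S) → (∀ s ∈ L, s.op = true → OrSelOK s.sel) →
      CombHereditary (grow U L)
  | [], _, _, _ => hU
  | s :: L, hL, hS, h1 => by
    rw [List.map_cons, List.nodup_cons] at hL
    have ih := combHereditary_grow_five_notTwoThree hUup hUS hU L hL.2 (fun t ht => hS t (List.mem_cons_of_mem s ht))
      fun t ht => h1 t (List.mem_cons_of_mem s ht)
    have hup := isUpperSet_grow hUup L
    have hig := secAt_grow_of_notMem hUS L (hS s List.mem_cons_self) hL.1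
    show CombHereditary (mixStep (grow U L) s)
    unfold mixStep
    cases hop : s.op
    · exact combHereditary_andCoord _ s.coord s.sel hig ih
    · rcases h1 s List.mem_cons_self hop with ⟨i, hi⟩ | ⟨u, hu⟩ | hall
      · rw [hi]; exact combHereditary_orCoord_sel _ s.coord i hig ih
      · rw [hu]; exact combHereditary_orCoord_five_allBut' _ s.coord u hup hig ih
      · rw [hall]; exact combHereditary_orCoord_five_all _ s.coord hup hig ih

/-- Law-level shadow: all rows of the grown quintuple are nonnegative under every product measure. [this work] -/
theorem sahiE_grow_five_notTwoThree_nonneg {U : Fin 5 → Set (Set ι)} (hUup : ∀ j, IsUpperSet (U j)) {S : Set ι} (hUS : ∀ j, DeterminedBy (U j) S)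
    (hU : CombHereditary U) (L : List (MixStep ι 5)) (hL : (L.map MixStep.coord).Nodup) (hS : ∀ s ∈ L, s.coord ∉ S)
    (h1 : ∀ s ∈ L, s.op = true → OrSelOK s.sel) (p : ι → unitInterval) (m : ℕ) (K : Fin m → Finset (Fin 5)) :
    0 ≤ sahiE (bernoulliWeight p) m (fun j => ind (⋂ i ∈ K j, grow U L i)) :=
  ((combHereditary_grow_five_notTwoThree hUup hUS hU L hL hS h1).hereditaryAllOrders p) m K

/-- **FIVE COMMON-ORDER MONOTONE READ-ONCE DECISION LISTS in which every coordinate is an accepting literal of `≤ 1` or `≥ 4` of them are hereditarily comb-positive.**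
[this work] -/
theorem combHereditary_caterpillar_five_notTwoThree (c : Fin 5 → Bool) (L : List (MixStep ι 5)) (hL : (L.map MixStep.coord).Nodup)
    (h1 : ∀ s ∈ L, s.op = true → OrSelOK s.sel) : CombHereditary (caterpillar c L) := by
  rw [caterpillar_eq_grow]
  refine combHereditary_grow_five_notTwoThree (S := (∅ : Set ι)) (fun j => ?_) (fun j => ?_) (combHereditary_constFamily c) L hL
    (fun s _ => Set.notMem_empty _) h1
  · cases c j
    · exact isUpperSet_empty
    · exact isUpperSet_univ
  · cases c j
    · rw [Literature.Probability.Percolation.determinedBy_iff]; intro ω ω' _; simp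
    · exact Literature.Probability.Percolation.determinedBy_univ _

/-- In particular `E_5 ≥ 0` for five such decision lists under every product measure. [this work] -/
theorem sahiE_five_caterpillar_notTwoThree_nonneg (c : Fin 5 → Bool) (L : List (MixStep ι 5)) (hL : (L.map MixStep.coord).Nodup)
    (h1 : ∀ s ∈ L, s.op = true → OrSelOK s.sel) (p : ι → unitInterval) :
    0 ≤ sahiE (bernoulliWeight p) 5 (fun j => ind (caterpillar c L j)) := by
  have h := ((combHereditary_caterpillar_five_notTwoThree c L hL h1).hereditaryAllOrders p) 5 (fun j => {j})
  refine le_of_le_of_eq h ?_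
  congr 1; funext j
  rw [Finset.set_biInter_singleton]

end SahiCombMix

end Summit.CriticalPhenomena.PercolationContinuityZ3.Theorems

end
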